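import Literature.AlgebraicGeometry.GroupSchemes.BirationalGroupLawGenericSection
import Literature.AlgebraicGeometry.GroupSchemes.BirationalGroupLawLeftTranslate
import Literature.AlgebraicGeometry.GroupSchemes.BirationalGroupLawChartShears
import Literature.AlgebraicGeometry.Morphisms.GraphClosure
import HarnessLib

/-!
# Artin's chart for the maximal law, with its shears
# (Artin, *Néron models*, §2, Lemma 2.3 and (2.5))

Topic `Literature/AlgebraicGeometry/GroupSchemes`, namespace `Literature.AlgebraicGeometry.GroupSchemes`.
KERNEL ONLY: one theorem; no definition, no named fact, no instance, no `sorry`.  Cell `hodgecm-mathlib`, road W, piece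
(G0b)-F2 of the maximalisation step.  This is ★ `BirationalGroupLaw.exists_chart_graphClosure` (same construction,
same proof: for `z = (a, b, c)` in the closure of the graph of `mul`, a section `x` with `xa`, `xc`, `(xa)b` defined
and the chart `(a′, b′) ↦ x⁻¹((xa′)b′)` on an open `V ∋ (a, b)`, agreeing with `mul` on `V ∩ dom`) with TWO MORE
conclusions needed to make the maximal law a birational group law ([Artin1986NeronModels] (2.5); [EdixhovenRomagny]
Thm. 3.18): the shears `(pr₁, v)` and `(v, pr₂) : V → 𝒳 ×_S 𝒳` of the chart are OPEN IMMERSIONS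
(★ `isOpenImmersion_chartShears`: they are `(λ × λ)⁻¹ ∘ Φ ∘ (λ × 𝟙)` and `(λ × 𝟙)⁻¹ ∘ Ψ ∘ (λ × 𝟙)`).

* `BirationalGroupLaw.exists_chart_graphClosure_shears`.

## References
* [Artin1986NeronModels] M. Artin, *Néron models*, in *Arithmetic Geometry*, Springer 1986, §2, Lemma 2.3, (2.5).
* [EdixhovenRomagny] B. Edixhoven, M. Romagny, *Group schemes out of birational group laws*, Thm. 3.18, Lemma 3.19.
-/

set_option autoImplicit false

noncomputable section

open CategoryTheory CategoryTheory.Limits AlgebraicGeometry TopologicalSpace Topology MonoidalCategory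
  CartesianMonoidalCategory

namespace Literature.AlgebraicGeometry.GroupSchemes

universe u

variable {S : Scheme.{u}} {𝒳 : Over S}

namespace BirationalGroupLaw

variable (L : BirationalGroupLaw 𝒳) [S.IsSeparated] [IsSeparated 𝒳.hom] [UniversallyOpen 𝒳.hom]
  [GeometricallyIrreducible 𝒳.hom] [IrreducibleSpace 𝒳.left] [IsReduced ↑(𝒳 ⊗ 𝒳).left]
  [QuasiCompact (pullback.lift L.dom.ι L.mul L.mul_comp.symm : (L.dom : Scheme.{u}) ⟶ pullback (𝒳 ⊗ 𝒳).hom 𝒳.hom)]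

/-- **Artin's chart with its shears** ([Artin1986NeronModels] §2, Lemma 2.3 and (2.5)): for `L` strict (standing
hypotheses) with sections dense in every fibre and a point `z` of the scheme-theoretic image of the graph morphism
`(ι, mul)`, there are an open `V ∋ pr₁₂(z)` of `𝒳 ×_S 𝒳` and `v : V → 𝒳` agreeing with `mul` on `V ∩ dom`, over `S`,
whose shears `(pr₁, v)` and `(v, pr₂) : V → 𝒳 ×_S 𝒳` are open immersions.
[cite: Artin1986NeronModels, Lemma 2.3 and (2.5) (p. 222)] [cite: EdixhovenRomagny, Thm. 3.18] -/
theorem exists_chart_graphClosure_shears (hL : L.IsStrict)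
    (hsec : ∀ (x : 𝒳.left) (Ω : 𝒳.left.Opens), x ∈ Ω →
      ∃ a : S ⟶ 𝒳.left, a ≫ 𝒳.hom = 𝟙 S ∧ ∃ s : S, a.base s ∈ Ω ∧ 𝒳.hom.base (a.base s) = 𝒳.hom.base x)
    (z : ↥((pullback.lift L.dom.ι L.mul L.mul_comp.symm :
      (L.dom : Scheme.{u}) ⟶ pullback (𝒳 ⊗ 𝒳).hom 𝒳.hom).image)) :
    ∃ (V : (𝒳 ⊗ 𝒳).left.Opens) (v : (V : Scheme.{u}) ⟶ 𝒳.left),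
      ((pullback.lift L.dom.ι L.mul L.mul_comp.symm :
          (L.dom : Scheme.{u}) ⟶ pullback (𝒳 ⊗ 𝒳).hom 𝒳.hom).imageι ≫ pullback.fst (𝒳 ⊗ 𝒳).hom 𝒳.hom).base z
        ∈ V ∧
      (𝒳 ⊗ 𝒳).left.homOfLE (inf_le_left : V ⊓ L.dom ≤ V) ≫ v =
        (𝒳 ⊗ 𝒳).left.homOfLE (inf_le_right : V ⊓ L.dom ≤ L.dom) ≫ L.mul ∧
      (∀ w, IsOpenImmersion (pullback.lift (V.ι ≫ (fst 𝒳 𝒳).left) v w : (V : Scheme.{u}) ⟶ (𝒳 ⊗ 𝒳).left)) ∧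
      (∀ w, IsOpenImmersion (pullback.lift v (V.ι ≫ (snd 𝒳 𝒳).left) w : (V : Scheme.{u}) ⟶ (𝒳 ⊗ 𝒳).left)) := by
  haveI : 𝒳.left.IsSeparated := by
    rw [Scheme.isSeparated_iff, ← terminal.comp_from 𝒳.hom]; infer_instance
  haveI hPirr : IrreducibleSpace ↑(𝒳 ⊗ 𝒳).left := by
    change IrreducibleSpace ↑(pullback 𝒳.hom 𝒳.hom); infer_instance
  -- the graph morphism `γ` and the projections `q₁`, `q₂` of its image
  let γ : (L.dom : Scheme.{u}) ⟶ pullback (𝒳 ⊗ 𝒳).hom 𝒳.hom := pullback.lift L.dom.ι L.mul L.mul_comp.symm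
  have hγ1 : γ ≫ pullback.fst _ _ = L.dom.ι := pullback.lift_fst _ _ _
  have hγ2 : γ ≫ pullback.snd _ _ = L.mul := pullback.lift_snd _ _ _
  have hfstS : (fst 𝒳 𝒳).left ≫ 𝒳.hom = (𝒳 ⊗ 𝒳).hom := Over.w (fst 𝒳 𝒳)
  have hsndS : (snd 𝒳 𝒳).left ≫ 𝒳.hom = (𝒳 ⊗ 𝒳).hom := Over.w (snd 𝒳 𝒳)
  have hext : ∀ {T : Scheme.{u}} (f g : T ⟶ (𝒳 ⊗ 𝒳).left), f ≫ (fst 𝒳 𝒳).left = g ≫ (fst 𝒳 𝒳).left →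
      f ≫ (snd 𝒳 𝒳).left = g ≫ (snd 𝒳 𝒳).left → f = g := fun f g h1 h2 => pullback.hom_ext h1 h2
  -- the morphisms `α = (v, a)` and `Θ = (v·a, b)` on `W = 𝒳 ×_S (𝒳 ×_S 𝒳)`
  have hwα : pullback.fst 𝒳.hom (𝒳 ⊗ 𝒳).hom ≫ 𝒳.hom =
      (pullback.snd 𝒳.hom (𝒳 ⊗ 𝒳).hom ≫ (fst 𝒳 𝒳).left) ≫ 𝒳.hom := by
    rw [Category.assoc, hfstS, pullback.condition]
  let α : pullback 𝒳.hom (𝒳 ⊗ 𝒳).hom ⟶ (𝒳 ⊗ 𝒳).left :=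
    pullback.lift (pullback.fst 𝒳.hom (𝒳 ⊗ 𝒳).hom) (pullback.snd 𝒳.hom (𝒳 ⊗ 𝒳).hom ≫ (fst 𝒳 𝒳).left) hwα
  have hα₁ : α ≫ (fst 𝒳 𝒳).left = pullback.fst 𝒳.hom (𝒳 ⊗ 𝒳).hom := pullback.lift_fst _ _ _
  have hα₂ : α ≫ (snd 𝒳 𝒳).left = pullback.snd 𝒳.hom (𝒳 ⊗ 𝒳).hom ≫ (fst 𝒳 𝒳).left :=
    pullback.lift_snd _ _ _
  have hresα : (α ∣_ L.dom) ≫ L.dom.ι = (α ⁻¹ᵁ L.dom).ι ≫ α := morphismRestrict_ι _ _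
  have hαS : α ≫ (𝒳 ⊗ 𝒳).hom = pullback.fst 𝒳.hom (𝒳 ⊗ 𝒳).hom ≫ 𝒳.hom := by
    rw [← hα₁, Category.assoc, hfstS]
  have hwΘ : ((α ∣_ L.dom) ≫ L.mul) ≫ 𝒳.hom =
      ((α ⁻¹ᵁ L.dom).ι ≫ pullback.snd 𝒳.hom (𝒳 ⊗ 𝒳).hom ≫ (snd 𝒳 𝒳).left) ≫ 𝒳.hom := by
    rw [Category.assoc, L.mul_comp, reassoc_of% hresα, hαS, pullback.condition, Category.assoc, Category.assoc,
      hsndS]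
  let Θ : ((α ⁻¹ᵁ L.dom : (pullback 𝒳.hom (𝒳 ⊗ 𝒳).hom).Opens) : Scheme.{u}) ⟶ (𝒳 ⊗ 𝒳).left :=
    pullback.lift ((α ∣_ L.dom) ≫ L.mul) ((α ⁻¹ᵁ L.dom).ι ≫ pullback.snd 𝒳.hom (𝒳 ⊗ 𝒳).hom ≫ (snd 𝒳 𝒳).left) hwΘ
  have hΘ₁ : Θ ≫ (fst 𝒳 𝒳).left = (α ∣_ L.dom) ≫ L.mul := pullback.lift_fst _ _ _
  have hΘ₂ : Θ ≫ (snd 𝒳 𝒳).left = (α ⁻¹ᵁ L.dom).ι ≫ pullback.snd 𝒳.hom (𝒳 ⊗ 𝒳).hom ≫ (snd 𝒳 𝒳).left :=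
    pullback.lift_snd _ _ _
  have hc₀ : 𝒳.hom.base ((γ.imageι ≫ pullback.snd _ _).base z) =
      (𝒳 ⊗ 𝒳).hom.base ((γ.imageι ≫ pullback.fst _ _).base z) := by
    change (γ.imageι ≫ pullback.snd _ _ ≫ 𝒳.hom).base z = (γ.imageι ≫ pullback.fst _ _ ≫ (𝒳 ⊗ 𝒳).hom).base z
    rw [pullback.condition]
  -- STEP A: the section `x`
  obtain ⟨x, hx, hxa, hxc, hxab⟩ := L.exists_section_translates_defined hL hsec α hα₁ hα₂ Θ hΘ₁ hΘ₂
    ((γ.imageι ≫ pullback.fst _ _).base z) ((γ.imageι ≫ pullback.snd _ _).base z) hc₀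
  -- STEP B: the chart.  The slice `σ = (x ∘ π, 𝟙)`, the open `A = σ⁻¹ dom` and the translate `lam = mul ∘ σ|_A`
  let σ : 𝒳.left ⟶ (𝒳 ⊗ 𝒳).left :=
    pullback.lift (𝒳.hom ≫ x) (𝟙 𝒳.left) (by rw [Category.assoc, hx, Category.comp_id, Category.id_comp])
  have hσ1 : σ ≫ (fst 𝒳 𝒳).left = 𝒳.hom ≫ x := pullback.lift_fst _ _ _
  have hσ2 : σ ≫ (snd 𝒳 𝒳).left = 𝟙 _ := pullback.lift_snd _ _ _
  have hσS : σ ≫ (𝒳 ⊗ 𝒳).hom = 𝒳.hom := by rw [← hsndS, reassoc_of% hσ2]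
  let A : 𝒳.left.Opens := σ ⁻¹ᵁ L.dom
  have hrA : Set.range (A.ι ≫ σ).base ⊆ Set.range L.dom.ι.base := by
    rintro _ ⟨a, rfl⟩
    rw [Scheme.Opens.range_ι]
    change A.ι.base a ∈ A
    rw [← SetLike.mem_coe, ← Scheme.Opens.range_ι]; exact ⟨a, rfl⟩
  let e : (A : Scheme.{u}) ⟶ (L.dom : Scheme.{u}) := IsOpenImmersion.lift L.dom.ι (A.ι ≫ σ) hrA
  have he : e ≫ L.dom.ι = A.ι ≫ σ := IsOpenImmersion.lift_fac _ _ _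
  let lam : (A : Scheme.{u}) ⟶ 𝒳.left := e ≫ L.mul
  haveI hlamo : IsOpenImmersion lam := L.isOpenImmersion_sliceLift_comp_mul 𝒳 x hx A e he (fun _ h => h)
  have hlamS : lam ≫ 𝒳.hom = A.ι ≫ 𝒳.hom := by
    change (e ≫ L.mul) ≫ 𝒳.hom = _
    rw [Category.assoc, L.mul_comp, reassoc_of% he, hσS]
  -- `V₁ = pr₁⁻¹ A`, `m₁ = (lam × id) : V₁ → 𝒳 ×_S 𝒳`
  let V₁ : (𝒳 ⊗ 𝒳).left.Opens := (fst 𝒳 𝒳).left ⁻¹ᵁ A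
  have hres₁ : ((fst 𝒳 𝒳).left ∣_ A) ≫ A.ι = V₁.ι ≫ (fst 𝒳 𝒳).left := morphismRestrict_ι _ _
  have hw₁ : (((fst 𝒳 𝒳).left ∣_ A) ≫ lam) ≫ 𝒳.hom = (V₁.ι ≫ (snd 𝒳 𝒳).left) ≫ 𝒳.hom := by
    rw [Category.assoc, hlamS, reassoc_of% hres₁, hfstS, Category.assoc, hsndS]
  let m₁ : (V₁ : Scheme.{u}) ⟶ (𝒳 ⊗ 𝒳).left :=
    pullback.lift (((fst 𝒳 𝒳).left ∣_ A) ≫ lam) (V₁.ι ≫ (snd 𝒳 𝒳).left) hw₁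
  have hm₁1 : m₁ ≫ (fst 𝒳 𝒳).left = ((fst 𝒳 𝒳).left ∣_ A) ≫ lam := pullback.lift_fst _ _ _
  have hm₁2 : m₁ ≫ (snd 𝒳 𝒳).left = V₁.ι ≫ (snd 𝒳 𝒳).left := pullback.lift_snd _ _ _
  have hm₁S : m₁ ≫ (𝒳 ⊗ 𝒳).hom = V₁.ι ≫ (𝒳 ⊗ 𝒳).hom := by rw [← hsndS, reassoc_of% hm₁2]
  -- `V₂ = m₁⁻¹ dom`, `m₂ = mul ∘ m₁ : V₂ → 𝒳` («`(xa)b`»), `V₃ = m₂⁻¹ (im lam)`, `v = lam⁻¹ ∘ m₂` («`x⁻¹((xa)b)`»)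
  let V₂ : (V₁ : Scheme.{u}).Opens := m₁ ⁻¹ᵁ L.dom
  have hres₂ : (m₁ ∣_ L.dom) ≫ L.dom.ι = V₂.ι ≫ m₁ := morphismRestrict_ι _ _
  let m₂ : (V₂ : Scheme.{u}) ⟶ 𝒳.left := (m₁ ∣_ L.dom) ≫ L.mul
  let V₃ : (V₂ : Scheme.{u}).Opens := m₂ ⁻¹ᵁ lam.opensRange
  have hr₃ : Set.range (V₃.ι ≫ m₂).base ⊆ Set.range lam.base := by
    rintro _ ⟨p, rfl⟩
    have hp : V₃.ι.base p ∈ V₃ := by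
      rw [← SetLike.mem_coe, ← Scheme.Opens.range_ι]; exact ⟨p, rfl⟩
    exact hp
  let v₃ : (V₃ : Scheme.{u}) ⟶ (A : Scheme.{u}) := IsOpenImmersion.lift lam (V₃.ι ≫ m₂) hr₃
  have hv₃ : v₃ ≫ lam = V₃.ι ≫ m₂ := IsOpenImmersion.lift_fac _ _ _
  -- STEP C: associativity — `(xa)b = x(ab)` whenever `ab ∈ A`, on `T`-valued points
  have core : ∀ {R : Scheme.{u}} (ρ : R ⟶ (V₂ : Scheme.{u})) (r₂ : R ⟶ (L.dom : Scheme.{u}))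
      (r₃ : R ⟶ (A : Scheme.{u})), ρ ≫ V₂.ι ≫ V₁.ι = r₂ ≫ L.dom.ι → r₃ ≫ A.ι = r₂ ≫ L.mul →
      ρ ≫ m₂ = r₃ ≫ lam := by
    intro R ρ r₂ r₃ h₁ h₂
    -- the four `dom`-valued points computing `x·a`, `a·b`, `(xa)·b`, `x·(ab)`
    have hbase : r₂ ≫ L.mul ≫ 𝒳.hom = ρ ≫ V₂.ι ≫ V₁.ι ≫ (𝒳 ⊗ 𝒳).hom := by
      rw [L.mul_comp, ← Category.assoc, ← h₁, Category.assoc, Category.assoc]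
    refine L.assoc (a := ρ ≫ V₂.ι ≫ V₁.ι ≫ (𝒳 ⊗ 𝒳).hom ≫ x) (b := ρ ≫ V₂.ι ≫ V₁.ι ≫ (fst 𝒳 𝒳).left)
      (c := r₂ ≫ L.dom.ι ≫ (snd 𝒳 𝒳).left) (ab := (ρ ≫ V₂.ι ≫ ((fst 𝒳 𝒳).left ∣_ A)) ≫ lam)
      (bc := r₂ ≫ L.mul) (q₁ := (ρ ≫ V₂.ι ≫ ((fst 𝒳 𝒳).left ∣_ A)) ≫ e) (q₂ := r₂)
      (q₃ := ρ ≫ (m₁ ∣_ L.dom)) (q₄ := r₃ ≫ e) ⟨?_, ?_, ?_⟩ ⟨?_, rfl, rfl⟩ ⟨?_, ?_, ?_⟩ ⟨?_, ?_, ?_⟩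
    · rw [Category.assoc, reassoc_of% he, hσ1, Category.assoc, Category.assoc, reassoc_of% hres₁,
        reassoc_of% hfstS]
    · rw [Category.assoc, reassoc_of% he, hσ2, Category.comp_id, Category.assoc, Category.assoc, hres₁]
    · rw [Category.assoc]
    · rw [← reassoc_of% h₁]
    · rw [Category.assoc, reassoc_of% hres₂, hm₁1, Category.assoc, Category.assoc]
    · rw [Category.assoc, reassoc_of% hres₂, hm₁2, reassoc_of% h₁]
    · rw [Category.assoc]
    · rw [Category.assoc, reassoc_of% he, hσ1, reassoc_of% h₂, reassoc_of% hbase]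
    · rw [Category.assoc, reassoc_of% he, hσ2, Category.comp_id, h₂]
    · rw [Category.assoc]
  -- STEP D: `p₀ = q₁ z` lies in the chart. (1) `p₀ ∈ V₁`, i.e. `a₀ ∈ A`
  have hp₀V₁ : (γ.imageι ≫ pullback.fst _ _).base z ∈ V₁ := hxa
  obtain ⟨p₁, hp₁⟩ : (γ.imageι ≫ pullback.fst _ _).base z ∈ Set.range V₁.ι.base := by
    rw [Scheme.Opens.range_ι]; exact hp₀V₁
  -- (2) `p₁ ∈ V₂`, i.e. `(x·a₀, b₀) ∈ dom`: compare `m₁` with `Θ` through `κ = (x ∘ π, 𝟙) : V₁ → W`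
  have hwκ : (V₁.ι ≫ (𝒳 ⊗ 𝒳).hom ≫ x) ≫ 𝒳.hom = V₁.ι ≫ (𝒳 ⊗ 𝒳).hom := by
    rw [Category.assoc, Category.assoc, hx, Category.comp_id]
  let κ : (V₁ : Scheme.{u}) ⟶ pullback 𝒳.hom (𝒳 ⊗ 𝒳).hom := pullback.lift (V₁.ι ≫ (𝒳 ⊗ 𝒳).hom ≫ x) V₁.ι hwκ
  have hκ1 : κ ≫ pullback.fst _ _ = V₁.ι ≫ (𝒳 ⊗ 𝒳).hom ≫ x := pullback.lift_fst _ _ _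
  have hκ2 : κ ≫ pullback.snd _ _ = V₁.ι := pullback.lift_snd _ _ _
  have hκα : κ ≫ α = ((fst 𝒳 𝒳).left ∣_ A) ≫ e ≫ L.dom.ι := by
    refine hext _ _ ?_ ?_
    · rw [Category.assoc, hα₁, hκ1, Category.assoc, Category.assoc, reassoc_of% he, hσ1, reassoc_of% hres₁,
        reassoc_of% hfstS]
    · rw [Category.assoc, hα₂, reassoc_of% hκ2, Category.assoc, Category.assoc, reassoc_of% he, hσ2,
        Category.comp_id, hres₁]
  have hrκ : Set.range κ.base ⊆ Set.range (α ⁻¹ᵁ L.dom).ι.base := by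
    rintro _ ⟨p, rfl⟩
    rw [Scheme.Opens.range_ι]
    change (κ ≫ α).base p ∈ L.dom
    rw [hκα, ← SetLike.mem_coe, ← Scheme.Opens.range_ι]
    exact ⟨_, rfl⟩
  let κ' : (V₁ : Scheme.{u}) ⟶ ((α ⁻¹ᵁ L.dom : (pullback 𝒳.hom (𝒳 ⊗ 𝒳).hom).Opens) : Scheme.{u}) :=
    IsOpenImmersion.lift (α ⁻¹ᵁ L.dom).ι κ hrκ
  have hκ' : κ' ≫ (α ⁻¹ᵁ L.dom).ι = κ := IsOpenImmersion.lift_fac _ _ _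
  have hκ'res : κ' ≫ (α ∣_ L.dom) = ((fst 𝒳 𝒳).left ∣_ A) ≫ e := by
    rw [← cancel_mono L.dom.ι, Category.assoc, hresα, reassoc_of% hκ', hκα, Category.assoc]
  have hκ'Θ : κ' ≫ Θ = m₁ := by
    refine hext _ _ ?_ ?_
    · rw [Category.assoc, hΘ₁, reassoc_of% hκ'res, hm₁1]
    · rw [Category.assoc, hΘ₂, reassoc_of% hκ', reassoc_of% hκ2, hm₁2]
  have hκp₁ : κ.base p₁ = (pullback.lift ((𝒳 ⊗ 𝒳).hom ≫ x) (𝟙 (𝒳 ⊗ 𝒳).left)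
      (by rw [Category.assoc, hx, Category.comp_id, Category.id_comp])).base
      ((γ.imageι ≫ pullback.fst _ _).base z) := by
    have : κ = V₁.ι ≫ pullback.lift ((𝒳 ⊗ 𝒳).hom ≫ x) (𝟙 (𝒳 ⊗ 𝒳).left)
        (by rw [Category.assoc, hx, Category.comp_id, Category.id_comp]) := by
      apply pullback.hom_ext
      · rw [hκ1, Category.assoc, pullback.lift_fst]
      · rw [hκ2, Category.assoc, pullback.lift_snd, Category.comp_id]
    rw [this, Scheme.Hom.comp_apply, hp₁]
  obtain ⟨w', hw'Θ, hw'⟩ := hxab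
  have hκ'p₁ : κ'.base p₁ = w' := (α ⁻¹ᵁ L.dom).ι.isOpenEmbedding.injective (by
    change (κ' ≫ (α ⁻¹ᵁ L.dom).ι).base p₁ = _
    rw [hκ', hκp₁]; exact hw'.symm)
  have hp₁V₂ : p₁ ∈ V₂ := by
    change m₁.base p₁ ∈ L.dom
    rw [← hκ'Θ, Scheme.Hom.comp_apply, hκ'p₁]
    exact hw'Θ
  obtain ⟨p₂, hp₂⟩ : p₁ ∈ Set.range V₂.ι.base := by rw [Scheme.Opens.range_ι]; exact hp₁V₂
  -- a point `d ∈ dom` with `mul d ∈ A` (`A`, `im mul` are non-empty opens of the irreducible `𝒳`)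
  obtain ⟨a₁, ha₁⟩ : (fst 𝒳 𝒳).left.base ((γ.imageι ≫ pullback.fst _ _).base z) ∈ Set.range A.ι.base := by
    rw [Scheme.Opens.range_ι]; exact hxa
  let Ψ' : (L.dom : Scheme.{u}) ⟶ (𝒳 ⊗ 𝒳).left := L.shearRight.left
  haveI hΨo : IsOpenImmersion Ψ' := L.isOpenImmersion_shearRight
  have hΨ1 : Ψ' ≫ (fst 𝒳 𝒳).left = L.mul :=
    congrArg CommaMorphism.left (LawData.shearRight_fst 𝒳 L.dom L.mul L.mul_comp)
  have hmulo : IsOpen (Set.range L.mul.base) := by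
    have hfo : IsOpenMap (fst 𝒳 𝒳).left.base := (pullback.fst 𝒳.hom 𝒳.hom).isOpenMap
    rw [← hΨ1, Scheme.Hom.comp_base, TopCat.coe_comp, Set.range_comp]
    exact hfo _ Ψ'.isOpenEmbedding.isOpen_range
  obtain ⟨_, ⟨d, rfl⟩, hdA⟩ : (Set.range L.mul.base ∩ (A : Set 𝒳.left)).Nonempty :=
    nonempty_preirreducible_inter hmulo A.isOpen ⟨_, ⟨e.base a₁, rfl⟩⟩ ⟨_, hxa⟩
  -- (3) `p₂ ∈ V₃`, i.e. `(x·a₀)·b₀ ∈ im lam`: `(xa)b = x(ab)` (STEP C) holds on a dense open of the graph, hence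
  -- `(xa)b = x c` on (an open `Γ'` of) its closure `Γ̄`, both sides mapping to the separated `𝒳`
  let Γ' : (γ.image : Scheme.{u}).Opens :=
    ((γ.imageι ≫ pullback.fst _ _) ⁻¹ᵁ (V₁.ι ''ᵁ V₂)) ⊓ ((γ.imageι ≫ pullback.snd _ _) ⁻¹ᵁ A)
  have hzΓ' : z ∈ Γ' := Opens.mem_inf.mpr ⟨⟨p₁, hp₁V₂, hp₁⟩, hxc⟩
  obtain ⟨z', hz'⟩ : z ∈ Set.range Γ'.ι.base := by rw [Scheme.Opens.range_ι]; exact hzΓ'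
  have hΓ'mem : ∀ y : ↥Γ', Γ'.ι.base y ∈ Γ' := fun y => by
    rw [← SetLike.mem_coe, ← Scheme.Opens.range_ι]; exact ⟨y, rfl⟩
  have hrℓ₁ : Set.range (Γ'.ι ≫ γ.imageι ≫ pullback.fst _ _).base ⊆ Set.range (V₂.ι ≫ V₁.ι).base := by
    rintro _ ⟨y, rfl⟩
    obtain ⟨⟨p, hpV₂, hp⟩, -⟩ := Opens.mem_inf.mp (hΓ'mem y)
    obtain ⟨p', rfl⟩ : p ∈ Set.range V₂.ι.base := by rw [Scheme.Opens.range_ι]; exact hpV₂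
    exact ⟨p', by simp only [Scheme.Hom.comp_apply] at hp ⊢; exact hp⟩
  have hrℓ₂ : Set.range (Γ'.ι ≫ γ.imageι ≫ pullback.snd _ _).base ⊆ Set.range A.ι.base := by
    rintro _ ⟨y, rfl⟩
    rw [Scheme.Opens.range_ι]
    exact (Opens.mem_inf.mp (hΓ'mem y)).2
  let ℓ₁ : (Γ' : Scheme.{u}) ⟶ (V₂ : Scheme.{u}) :=
    IsOpenImmersion.lift (V₂.ι ≫ V₁.ι) (Γ'.ι ≫ γ.imageι ≫ pullback.fst _ _) hrℓ₁
  have hℓ₁ : ℓ₁ ≫ V₂.ι ≫ V₁.ι = Γ'.ι ≫ γ.imageι ≫ pullback.fst _ _ := IsOpenImmersion.lift_fac _ _ _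
  let ℓ₂ : (Γ' : Scheme.{u}) ⟶ (A : Scheme.{u}) :=
    IsOpenImmersion.lift A.ι (Γ'.ι ≫ γ.imageι ≫ pullback.snd _ _) hrℓ₂
  have hℓ₂ : ℓ₂ ≫ A.ι = Γ'.ι ≫ γ.imageι ≫ pullback.snd _ _ := IsOpenImmersion.lift_fac _ _ _
  -- the dense open `G ⊆ dom` of `(a, b)` with `(a, b, ab) ∈ Γ'` and `ab ∈ A`, mapping to `Γ'` by `δ`
  let G : (L.dom : Scheme.{u}).Opens := (γ.toImage ⁻¹ᵁ Γ') ⊓ (L.mul ⁻¹ᵁ A)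
  let δ : (G : Scheme.{u}) ⟶ (Γ' : Scheme.{u}) :=
    (L.dom : Scheme.{u}).homOfLE (inf_le_left : G ≤ γ.toImage ⁻¹ᵁ Γ') ≫ (γ.toImage ∣_ Γ')
  have hδ : δ ≫ Γ'.ι = G.ι ≫ γ.toImage := by
    change ((L.dom : Scheme.{u}).homOfLE _ ≫ (γ.toImage ∣_ Γ')) ≫ Γ'.ι = _
    rw [Category.assoc, morphismRestrict_ι, Scheme.homOfLE_ι_assoc]
  haveI : Nonempty ↥(L.dom : Scheme.{u}) := ⟨e.base a₁⟩
  haveI : IrreducibleSpace ↥(L.dom : Scheme.{u}) := L.dom.ι.isOpenEmbedding.irreducibleSpace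
  have hGne : (G : Set ↥(L.dom : Scheme.{u})).Nonempty := by
    change ((γ.toImage ⁻¹ᵁ Γ' : Set ↥(L.dom : Scheme.{u})) ∩ (L.mul ⁻¹ᵁ A : Set ↥(L.dom : Scheme.{u}))).Nonempty
    refine nonempty_preirreducible_inter (γ.toImage ⁻¹ᵁ Γ').isOpen (L.mul ⁻¹ᵁ A).isOpen ?_ ⟨d, hdA⟩
    exact γ.toImage.denseRange.exists_mem_open Γ'.isOpen ⟨z, hzΓ'⟩
  have hGdense : Dense (G : Set ↥(L.dom : Scheme.{u})) := G.isOpen.dense hGne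
  haveI : IsDominant ((L.dom : Scheme.{u}).homOfLE (inf_le_left : G ≤ γ.toImage ⁻¹ᵁ Γ')) :=
    Opens.isDominant_homOfLE hGdense _
  haveI : IsDominant (γ.toImage ∣_ Γ') := IsZariskiLocalAtTarget.restrict (P := @IsDominant) inferInstance Γ'
  haveI hδdom : IsDominant δ := inferInstance
  -- on `G`, `(xa)b = x(ab)` (STEP C), i.e. `δ` equalises `ℓ₁ ≫ m₂` and `ℓ₂ ≫ lam`
  have hδeq : δ ≫ ℓ₁ ≫ m₂ = δ ≫ ℓ₂ ≫ lam := by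
    rw [← Category.assoc, ← Category.assoc]
    refine core (δ ≫ ℓ₁) G.ι (δ ≫ ℓ₂) ?_ ?_
    · rw [Category.assoc, hℓ₁, reassoc_of% hδ, Scheme.Hom.toImage_imageι_assoc, hγ1]
    · rw [Category.assoc, hℓ₂, reassoc_of% hδ, Scheme.Hom.toImage_imageι_assoc, hγ2]
  -- hence on the closure of its (dense) image: at `z'`
  have hzE : z' ∈ Set.range (equalizer.ι (ℓ₁ ≫ m₂) (ℓ₂ ≫ lam)).base := by
    have hsub : Set.range δ.base ⊆ Set.range (equalizer.ι (ℓ₁ ≫ m₂) (ℓ₂ ≫ lam)).base := by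
      have : δ = equalizer.lift δ hδeq ≫ equalizer.ι _ _ := (equalizer.lift_ι _ _).symm
      rw [this, Scheme.Hom.comp_base, TopCat.coe_comp]
      exact Set.range_comp_subset_range _ _
    have hcl := closure_minimal hsub (equalizer.ι (ℓ₁ ≫ m₂) (ℓ₂ ≫ lam)).isClosedEmbedding.isClosed_range
    rw [δ.denseRange.closure_range] at hcl
    exact hcl (Set.mem_univ _)
  obtain ⟨ε, hε⟩ := hzE
  have hgz : m₂.base (ℓ₁.base z') = lam.base (ℓ₂.base z') := by
    have := congrArg (fun φ => φ.base ε) (equalizer.condition (ℓ₁ ≫ m₂) (ℓ₂ ≫ lam))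
    simp only [Scheme.Hom.comp_apply] at this
    rwa [hε] at this
  have hℓ₁z : ℓ₁.base z' = p₂ := (V₂.ι ≫ V₁.ι).isOpenEmbedding.injective (by
    change (ℓ₁ ≫ V₂.ι ≫ V₁.ι).base z' = _
    rw [hℓ₁]
    simp only [Scheme.Hom.comp_apply]
    rw [hz', hp₂, hp₁, Scheme.Hom.comp_apply])
  have hp₂V₃ : p₂ ∈ V₃ := by
    change m₂.base p₂ ∈ lam.opensRange
    exact ⟨ℓ₂.base z', by rw [← hℓ₁z]; exact hgz.symm⟩
  obtain ⟨p₃, hp₃⟩ : p₂ ∈ Set.range V₃.ι.base := by rw [Scheme.Opens.range_ι]; exact hp₂V₃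
  -- STEP E: the chart `(im j, lam⁻¹ ∘ m₂)`, `j = V₃ ↪ 𝒳 ×_S 𝒳`, extends `mul` near `p₀`
  haveI : IsOpenImmersion (V₃.ι ≫ V₂.ι ≫ V₁.ι) := inferInstance
  -- the chart shears are open immersions (★ `isOpenImmersion_chartShears` with `T := V₃`, `g₁ := V₃.ι`, `g₂ := v₃`)
  have e1 : (v₃ ≫ A.ι) ≫ 𝒳.hom = V₃.ι ≫ V₂.ι ≫ V₁.ι ≫ (𝒳 ⊗ 𝒳).hom := by
    rw [Category.assoc, ← hlamS, ← Category.assoc, hv₃, Category.assoc]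
    change V₃.ι ≫ ((m₁ ∣_ L.dom) ≫ L.mul) ≫ 𝒳.hom = _
    rw [Category.assoc, L.mul_comp, reassoc_of% hres₂, hm₁S]
  have wΦ' : (V₃.ι ≫ (m₁ ⁻¹ᵁ L.dom).ι ≫ ((fst 𝒳 𝒳).left ⁻¹ᵁ A).ι ≫ (fst 𝒳 𝒳).left) ≫ 𝒳.hom =
      (v₃ ≫ A.ι) ≫ 𝒳.hom := by
    rw [e1]; simp only [Category.assoc, hfstS]; rfl
  have wΨ' : (v₃ ≫ A.ι) ≫ 𝒳.hom =
      (V₃.ι ≫ (m₁ ⁻¹ᵁ L.dom).ι ≫ ((fst 𝒳 𝒳).left ⁻¹ᵁ A).ι ≫ (snd 𝒳 𝒳).left) ≫ 𝒳.hom := by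
    rw [e1]; simp only [Category.assoc, hsndS]; rfl
  obtain ⟨hΦo, hΨo⟩ := isOpenImmersion_chartShears A lam hlamS m₁ hm₁1 hm₁2 L V₃.ι v₃ hv₃ wΦ' wΨ'
  refine ⟨(V₃.ι ≫ V₂.ι ≫ V₁.ι).opensRange, (V₃.ι ≫ V₂.ι ≫ V₁.ι).isoOpensRange.inv ≫ v₃ ≫ A.ι, ?_, ?_, ?_, ?_⟩
  rotate_left 2
  · intro w
    have : pullback.lift ((V₃.ι ≫ V₂.ι ≫ V₁.ι).opensRange.ι ≫ (fst 𝒳 𝒳).left)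
        ((V₃.ι ≫ V₂.ι ≫ V₁.ι).isoOpensRange.inv ≫ v₃ ≫ A.ι) w = (V₃.ι ≫ V₂.ι ≫ V₁.ι).isoOpensRange.inv ≫
        pullback.lift (V₃.ι ≫ (m₁ ⁻¹ᵁ L.dom).ι ≫ ((fst 𝒳 𝒳).left ⁻¹ᵁ A).ι ≫ (fst 𝒳 𝒳).left) (v₃ ≫ A.ι) wΦ' := by
      refine hext _ _ ?_ ?_
      · change _ ≫ pullback.fst _ _ = (_ ≫ _) ≫ pullback.fst _ _
        rw [pullback.lift_fst, Category.assoc, pullback.lift_fst]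
        exact (Scheme.Hom.isoOpensRange_inv_comp_assoc _ _).symm
      · change _ ≫ pullback.snd _ _ = (_ ≫ _) ≫ pullback.snd _ _
        rw [pullback.lift_snd, Category.assoc, pullback.lift_snd]
    rw [this]; exact @IsOpenImmersion.comp _ _ _ _ _ inferInstance hΦo
  · intro w
    have : pullback.lift ((V₃.ι ≫ V₂.ι ≫ V₁.ι).isoOpensRange.inv ≫ v₃ ≫ A.ι)
        ((V₃.ι ≫ V₂.ι ≫ V₁.ι).opensRange.ι ≫ (snd 𝒳 𝒳).left) w = (V₃.ι ≫ V₂.ι ≫ V₁.ι).isoOpensRange.inv ≫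
        pullback.lift (v₃ ≫ A.ι) (V₃.ι ≫ (m₁ ⁻¹ᵁ L.dom).ι ≫ ((fst 𝒳 𝒳).left ⁻¹ᵁ A).ι ≫ (snd 𝒳 𝒳).left) wΨ' := by
      refine hext _ _ ?_ ?_
      · change _ ≫ pullback.fst _ _ = (_ ≫ _) ≫ pullback.fst _ _
        rw [pullback.lift_fst, Category.assoc, pullback.lift_fst]
      · change _ ≫ pullback.snd _ _ = (_ ≫ _) ≫ pullback.snd _ _
        rw [pullback.lift_snd, Category.assoc, pullback.lift_snd]
        exact (Scheme.Hom.isoOpensRange_inv_comp_assoc _ _).symm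
    rw [this]; exact @IsOpenImmersion.comp _ _ _ _ _ inferInstance hΨo
  · refine ⟨p₃, ?_⟩
    change _ = (γ.imageι ≫ pullback.fst _ _).base z
    rw [← hp₁, ← hp₂, ← hp₃]
    simp only [Scheme.Hom.comp_apply]
  -- agreement with `mul` on `im j ∩ dom`: STEP C on the dense open `ab ∈ A`, then density (reduced/separated)
  have hQ'le : (V₃.ι ≫ V₂.ι ≫ V₁.ι).opensRange ⊓ L.dom ⊓ (L.dom.ι ''ᵁ (L.mul ⁻¹ᵁ A)) ≤
      (V₃.ι ≫ V₂.ι ≫ V₁.ι).opensRange ⊓ L.dom := inf_le_left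
  have hQ'dense : Dense (((V₃.ι ≫ V₂.ι ≫ V₁.ι).opensRange ⊓ L.dom ⊓ (L.dom.ι ''ᵁ (L.mul ⁻¹ᵁ A)) :
      (𝒳 ⊗ 𝒳).left.Opens) : Set ↑(𝒳 ⊗ 𝒳).left) := by
    refine (Opens.isOpen _).dense ?_
    rw [Opens.coe_inf, Opens.coe_inf]
    refine nonempty_preirreducible_inter ((Opens.isOpen _).inter L.dom.isOpen) (Opens.isOpen _)
      (nonempty_preirreducible_inter (Opens.isOpen _) L.dom.isOpen ⟨_, ⟨p₃, rfl⟩⟩ ⟨_, (e.base a₁).2⟩)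
      ⟨L.dom.ι.base d, ⟨d, hdA, rfl⟩⟩
  haveI : IsDominant ((𝒳 ⊗ 𝒳).left.homOfLE hQ'le) := Opens.isDominant_homOfLE hQ'dense _
  refine ext_of_isDominant ((𝒳 ⊗ 𝒳).left.homOfLE hQ'le) ?_
  -- the `dom`-point `r₂`, the `V₃`-point and the `A`-point `r₃` (`ab ∈ A`) of the test scheme `Q'`
  have hr₃ : Set.range (((𝒳 ⊗ 𝒳).left.homOfLE hQ'le ≫ (𝒳 ⊗ 𝒳).left.homOfLE inf_le_right) ≫ L.mul).base ⊆
      Set.range A.ι.base := by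
    rintro _ ⟨q, rfl⟩
    rw [Scheme.Opens.range_ι]
    have hqQ : (((𝒳 ⊗ 𝒳).left.homOfLE hQ'le ≫ (𝒳 ⊗ 𝒳).left.homOfLE inf_le_right) ≫ L.dom.ι).base q ∈
        (V₃.ι ≫ V₂.ι ≫ V₁.ι).opensRange ⊓ L.dom ⊓ (L.dom.ι ''ᵁ (L.mul ⁻¹ᵁ A)) := by
      rw [Category.assoc, Scheme.homOfLE_ι, Scheme.homOfLE_ι, ← SetLike.mem_coe, ← Scheme.Opens.range_ι]
      exact ⟨q, rfl⟩
    obtain ⟨d', hd'A, hd'⟩ := (Opens.mem_inf.mp hqQ).2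
    simp only [Scheme.Hom.comp_apply] at hd' ⊢
    rw [← L.dom.ι.isOpenEmbedding.injective hd']
    exact hd'A
  have key := core
    ((((𝒳 ⊗ 𝒳).left.homOfLE hQ'le ≫ (𝒳 ⊗ 𝒳).left.homOfLE inf_le_left) ≫
      (V₃.ι ≫ V₂.ι ≫ V₁.ι).isoOpensRange.inv) ≫ V₃.ι)
    ((𝒳 ⊗ 𝒳).left.homOfLE hQ'le ≫ (𝒳 ⊗ 𝒳).left.homOfLE inf_le_right)
    (IsOpenImmersion.lift A.ι _ hr₃) ?_ (IsOpenImmersion.lift_fac _ _ _)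
  · -- conclude from `key`: cancel the monomorphism `lam`, compose with `A.ι`
    have hfac : ((𝒳 ⊗ 𝒳).left.homOfLE hQ'le ≫ (𝒳 ⊗ 𝒳).left.homOfLE inf_le_left) ≫
        (V₃.ι ≫ V₂.ι ≫ V₁.ι).isoOpensRange.inv ≫ v₃ = IsOpenImmersion.lift A.ι _ hr₃ := by
      rw [← cancel_mono lam]
      simp only [Category.assoc]
      rw [hv₃]
      simpa only [Category.assoc] using key
    have := congrArg (· ≫ A.ι) hfac
    simp only [Category.assoc, IsOpenImmersion.lift_fac] at this
    exact this
  · simp only [Category.assoc, Scheme.Hom.isoOpensRange_inv_comp, Scheme.homOfLE_ι]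

end BirationalGroupLaw

end Literature.AlgebraicGeometry.GroupSchemes

end
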